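import Summits.AtomisticToContinuum.Crystallization.Theses.PhononSlackCertificates
import Literature.MathematicalPhysics.StatisticalMechanics.LennardJonesClusters

/-!
# The glue of line `Sketch` for the crux `FarFieldGapR` (stub `stub_glue`)

Support file for the crux `PhononSlackCertificates.FarFieldGapR` (stmt-AtomisticToContinuum-14969),
line `Sketch` (octahedral-poisoning collapse).  This is the BOOKKEEPING that turns the route's
support item `AllBadGap` (`∀ δ > 0 ∃ g > 0`, every `δ`-separated all-bad configuration has
`N · (e* + g) ≤ 𝓔_LJ`, `e* := ⨅_Q e(Q)` over periodic `Q`) plus four elementary statements,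
taken here as hypotheses and proved by the sibling stubs of the line,

* `hP` — poisoning of everything: at separation `δ ≤ 3/5` every `δ`-separated `y : Fin n → ℝ³`
  embeds into an all-bad `δ`-separated `y'` with `≤ #good(y)` extra particles and energy
  `≤ 𝓔(y) + K · #good(y)`;
* `hT` — decaying shell sum: `∑_{j ∈ T} |xᵢ - xⱼ|⁻⁶ ≤ 250 δ⁻³ R⁻³` if `T` lies beyond `R ≥ δ`;
* `hL` — locality of goodness under restriction to a sub-configuration;
* `hD` — the decomposition `∑_{i ∈ U} ½ ∑_{j ≠ i} V = 𝓔(x|_U) + ½ · cross terms`,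

into the verbatim body of the route decl `FarFieldGapR`.

PROOF.  Fix `δ > 0`, put `δ' := min δ (3/5)`, take `K` and the poisoning from `hP` at `δ'` and
`g₀` from `AllBadGap` at `δ'`.  Answer `g := g₀ / 2`, `R ≥ max (3/2) δ` so large that
`(250/12) δ⁻³ R⁻³ ≤ g₀ / 2`, and `C := K + |e*| + g₀ + (250/12) δ⁻⁶`.  Given a `δ`-separated `x`
and an all-bad set `U`, enumerate `U = Finset.univ.map e` (`e : Fin n ↪ Fin N`) and put
`y := x ∘ e`.  Then
`∑_{i ∈ U} (½ ∑_{j ≠ i} V - e*) = 𝓔(y) + ½ · cross - n · e*` (`hD`); the cross terms of an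
`R`-interior particle are `≥ -(250/6) δ⁻³ R⁻³` (`hT` and `V_LJ(r) ≥ -r⁻⁶/6`), those of any particle
of `U` are `≥ -(250/6) δ⁻⁶` (`sum_inv_pow_six_le`); the bulk is
`𝓔(y) ≥ M (e* + g₀) - K · #good(y) ≥ n (e* + g₀) - (K + |e*| + g₀) · #good(y)` (`hP`, `AllBadGap`,
`n ≤ M ≤ n + #good(y)`); and `#good(y) ≤ #∂_R U` because a good particle of `y` is bad in `x`, so by
`hL` some particle outside `U` lies within `3/2 ≤ R` of it.  Linear arithmetic concludes.

Leans on: the route decl `AllBadGap` (hypothesis), the tree's `sum_inv_pow_six_le`,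
`interactionEnergy`, `lennardJones`, `IsTwoShellGood`, and Mathlib.  No new definitions,
no named unproved facts.
-/

noncomputable section

open scoped BigOperators Classical

namespace Summit.AtomisticToContinuum.Crystallization.Theorems.PhononSlackCertificatesFarFieldGapR

open Literature.MathematicalPhysics.StatisticalMechanics Literature.Geometry.DiscreteGeometry
open Summit.AtomisticToContinuum.Crystallization.Theses.PhononSlackCertificates (AllBadGap FarFieldGapR)

/-! ## Private helpers -/

/-- The slack radius: for `δ, g₀ > 0` there is `R ≥ max (3/2) δ` with
`(250/12) · δ⁻³ · R⁻³ ≤ g₀ / 2` (take `R ≥ 250 / (6 g₀ δ³)` and use `R⁻³ ≤ R⁻¹` for `R ≥ 1`). -/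
private theorem glue_radius {δ g₀ : ℝ} (hδ : 0 < δ) (hg₀ : 0 < g₀) :
    ∃ R : ℝ, 3 / 2 ≤ R ∧ δ ≤ R ∧ 250 / 12 * (δ⁻¹ ^ 3 * R⁻¹ ^ 3) ≤ g₀ / 2 := by
  obtain ⟨R, hR32, hRδ, hRR₀⟩ :
      ∃ R : ℝ, 3 / 2 ≤ R ∧ δ ≤ R ∧ 250 / (6 * g₀ * δ ^ 3) ≤ R :=
    ⟨max (3 / 2) (max δ (250 / (6 * g₀ * δ ^ 3))), le_max_left _ _,
      (le_max_left _ _).trans (le_max_right _ _), (le_max_right _ _).trans (le_max_right _ _)⟩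
  refine ⟨R, hR32, hRδ, ?_⟩
  have hR1 : 1 ≤ R := le_trans (by norm_num) hR32
  have hR0 : 0 < R := by linarith
  have h₀ : 0 < 250 / (6 * g₀ * δ ^ 3) := by positivity
  have hinv : R⁻¹ ≤ 6 * g₀ * δ ^ 3 / 250 := by
    calc R⁻¹ ≤ (250 / (6 * g₀ * δ ^ 3))⁻¹ := inv_anti₀ h₀ hRR₀
      _ = 6 * g₀ * δ ^ 3 / 250 := inv_div _ _
  have hinv3 : R⁻¹ ^ 3 ≤ R⁻¹ :=
    pow_le_of_le_one (inv_nonneg.2 hR0.le) (inv_le_one_of_one_le₀ hR1) (by norm_num)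
  have hδ3 : δ⁻¹ ^ 3 * δ ^ 3 = 1 := by
    rw [inv_pow, inv_mul_cancel₀ (pow_ne_zero 3 hδ.ne')]
  calc 250 / 12 * (δ⁻¹ ^ 3 * R⁻¹ ^ 3)
      ≤ 250 / 12 * (δ⁻¹ ^ 3 * (6 * g₀ * δ ^ 3 / 250)) := by
        gcongr
        exact hinv3.trans hinv
    _ = g₀ / 2 * (δ⁻¹ ^ 3 * δ ^ 3) := by ring
    _ = g₀ / 2 := by rw [hδ3, mul_one]

/-- The attractive part dominates the Lennard-Jones potential from below:
`V_LJ(r) ≥ -(1/6) · r⁻⁶`. -/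
private theorem glue_neg_inv_pow_six_le (r : ℝ) : -(1 / 6 * r⁻¹ ^ 6) ≤ lennardJones r := by
  unfold lennardJones
  have h : (0 : ℝ) ≤ 1 / 12 * r⁻¹ ^ 12 := by positivity
  linarith

/-- **Cross terms of one site.**  In a `δ`-separated configuration `x` (`0 < δ ≤ R`), for a
particle `i ∈ U`: the interaction of `i` with `Uᶜ` is `≥ -(250/6) δ⁻³ R⁻³` if no particle outside
`U` lies within `R` of `x i` (decaying shell sum `hT`), and `≥ -(250/6) δ⁻⁶` in any case
(`sum_inv_pow_six_le`); both via `V_LJ(r) ≥ -r⁻⁶/6`. -/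
private theorem glue_cross_site {N : ℕ} (x : Fin N → EuclideanSpace ℝ (Fin 3)) {δ R : ℝ}
    (hδ : 0 < δ) (hδR : δ ≤ R) (hsep : ∀ i j : Fin N, i ≠ j → δ ≤ dist (x i) (x j))
    (hT : ∀ (i : Fin N) (T : Finset (Fin N)), (∀ j ∈ T, R ≤ dist (x i) (x j)) →
      ∑ j ∈ T, (dist (x i) (x j))⁻¹ ^ 6 ≤ 250 * (δ⁻¹ ^ 3 * R⁻¹ ^ 3))
    (U : Finset (Fin N)) {i : Fin N} (hi : i ∈ U) :
    -(250 / 6 * (δ⁻¹ ^ 3 * R⁻¹ ^ 3)) -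
        250 / 6 * δ⁻¹ ^ 6 * (if ∃ j : Fin N, j ∉ U ∧ dist (x j) (x i) ≤ R then 1 else 0) ≤
      ∑ j ∈ Uᶜ, lennardJones (dist (x i) (x j)) := by
  have hR : 0 < R := hδ.trans_le hδR
  have hLJ : -(1 / 6) * ∑ j ∈ Uᶜ, (dist (x i) (x j))⁻¹ ^ 6 ≤
      ∑ j ∈ Uᶜ, lennardJones (dist (x i) (x j)) := by
    rw [Finset.mul_sum]
    exact Finset.sum_le_sum fun j _ => by
      have := glue_neg_inv_pow_six_le (dist (x i) (x j))
      linarith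
  have ha : 0 ≤ 250 / 6 * (δ⁻¹ ^ 3 * R⁻¹ ^ 3) := by positivity
  have hb : 0 ≤ 250 / 6 * δ⁻¹ ^ 6 := by positivity
  split_ifs with hbd
  · -- a boundary particle: drop the repulsion and use the full shell sum
    have hS := sum_inv_pow_six_le x hδ hsep i
    have hsub : ∑ j ∈ Uᶜ, (dist (x i) (x j))⁻¹ ^ 6 ≤
        ∑ j ∈ Finset.univ.erase i, (dist (x i) (x j))⁻¹ ^ 6 :=
      Finset.sum_le_sum_of_subset_of_nonneg
        (fun j hj => Finset.mem_erase.2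
          ⟨fun h => Finset.mem_compl.1 hj (h ▸ hi), Finset.mem_univ _⟩)
        fun j _ _ => by positivity
    linarith
  · -- an interior particle: everything outside `U` is beyond `R`
    push Not at hbd
    have hS := hT i Uᶜ fun j hj => by
      rw [dist_comm]
      exact (hbd j (Finset.mem_compl.1 hj)).le
    linarith

/-- **Cross terms, summed over a sub-configuration `U = Finset.univ.map e`.**
`∑_k ∑_{j ∉ U} V(|x (e k) - x j|) ≥ -(250/6) δ⁻³ R⁻³ · n - (250/6) δ⁻⁶ · #∂_R U`. -/
private theorem glue_cross {N n : ℕ} (x : Fin N → EuclideanSpace ℝ (Fin 3)) (e : Fin n ↪ Fin N)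
    {δ R : ℝ} (hδ : 0 < δ) (hδR : δ ≤ R) (hsep : ∀ i j : Fin N, i ≠ j → δ ≤ dist (x i) (x j))
    (hT : ∀ (i : Fin N) (T : Finset (Fin N)), (∀ j ∈ T, R ≤ dist (x i) (x j)) →
      ∑ j ∈ T, (dist (x i) (x j))⁻¹ ^ 6 ≤ 250 * (δ⁻¹ ^ 3 * R⁻¹ ^ 3)) :
    -(250 / 6 * (δ⁻¹ ^ 3 * R⁻¹ ^ 3)) * n - 250 / 6 * δ⁻¹ ^ 6 *
        ((Finset.univ.filter fun k : Fin n =>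
          ∃ j : Fin N, j ∉ Finset.univ.map e ∧ dist (x j) (x (e k)) ≤ R).card : ℝ) ≤
      ∑ k : Fin n, ∑ j ∈ (Finset.univ.map e)ᶜ, lennardJones (dist (x (e k)) (x j)) := by
  have h := fun k : Fin n => glue_cross_site x hδ hδR hsep hT (Finset.univ.map e)
    (Finset.mem_map_of_mem e (Finset.mem_univ k))
  have hs := Finset.sum_le_sum fun k (_ : k ∈ (Finset.univ : Finset (Fin n))) => h k
  rw [Finset.sum_sub_distrib, Finset.sum_const, Finset.card_univ, Fintype.card_fin,
    nsmul_eq_mul, ← Finset.mul_sum, Finset.sum_boole] at hs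
  linarith

/-- **Good particles of `x ∘ e` are `R`-boundary particles of `U = Finset.univ.map e`**
(`R ≥ 3/2`), when every particle of `U` is bad in `x`: otherwise the whole `3/2`-neighbourhood
lies in `U` and locality `hL` would make the particle good in `x`. -/
private theorem glue_good_subset {N n : ℕ} (x : Fin N → EuclideanSpace ℝ (Fin 3))
    (e : Fin n ↪ Fin N) {R : ℝ} (hR : 3 / 2 ≤ R)
    (hL : ∀ k : Fin n, (∀ j : Fin N, dist (x j) (x (e k)) ≤ 3 / 2 → j ∈ Set.range e) →
      IsTwoShellGood (1 / 20) (47 / 50) 1 (x ∘ e) k →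
        IsTwoShellGood (1 / 20) (47 / 50) 1 x (e k))
    (hU : ∀ k : Fin n, ¬ IsTwoShellGood (1 / 20) (47 / 50) 1 x (e k)) :
    (Finset.univ.filter fun k : Fin n => IsTwoShellGood (1 / 20) (47 / 50) 1 (x ∘ e) k) ⊆
      Finset.univ.filter fun k : Fin n =>
        ∃ j : Fin N, j ∉ Finset.univ.map e ∧ dist (x j) (x (e k)) ≤ R := by
  intro k hk
  rw [Finset.mem_filter] at hk ⊢
  refine ⟨hk.1, ?_⟩
  by_contra hbd
  push Not at hbd
  refine hU k (hL k (fun j hj => ?_) hk.2)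
  have hjU : j ∈ Finset.univ.map e := by
    by_contra hj'
    exact absurd (hbd j hj') (not_lt.2 (hj.trans hR))
  obtain ⟨k', -, rfl⟩ := Finset.mem_map.1 hjU
  exact ⟨k', rfl⟩

/-- **The bulk bound.**  From the poisoning of `y` (`hpois`: an all-bad `δ'`-separated
super-configuration `y'` with `n ≤ M ≤ n + #good(y)` particles and `𝓔(y') ≤ 𝓔(y) + K · #good(y)`)
and the all-bad gap `hgap` (`M (E + g₀) ≤ 𝓔(y')`):
`n (E + g₀) - (K + |E| + g₀) · #good(y) ≤ 𝓔(y)`. -/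
private theorem glue_bulk {n : ℕ} (y : Fin n → EuclideanSpace ℝ (Fin 3)) {δ' g₀ K E : ℝ}
    (hg₀ : 0 < g₀)
    (hpois : ∃ (M : ℕ) (y' : Fin M → EuclideanSpace ℝ (Fin 3)) (ι : Fin n ↪ Fin M),
      (∀ k, y' (ι k) = y k) ∧
      (M : ℝ) ≤ n + Nat.card {k : Fin n // IsTwoShellGood (1 / 20) (47 / 50) 1 y k} ∧
      (∀ i j : Fin M, i ≠ j → δ' ≤ dist (y' i) (y' j)) ∧
      (∀ k, ¬ IsTwoShellGood (1 / 20) (47 / 50) 1 y' k) ∧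
      interactionEnergy lennardJones y' ≤ interactionEnergy lennardJones y +
        K * Nat.card {k : Fin n // IsTwoShellGood (1 / 20) (47 / 50) 1 y k})
    (hgap : ∀ (N : ℕ) (x : Fin N → EuclideanSpace ℝ (Fin 3)),
      (∀ i j : Fin N, i ≠ j → δ' ≤ dist (x i) (x j)) →
      (∀ i : Fin N, ¬ IsTwoShellGood (1 / 20) (47 / 50) 1 x i) →
      (N : ℝ) * (E + g₀) ≤ interactionEnergy lennardJones x) :
    (n : ℝ) * (E + g₀) -
        (K + |E| + g₀) * Nat.card {k : Fin n // IsTwoShellGood (1 / 20) (47 / 50) 1 y k} ≤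
      interactionEnergy lennardJones y := by
  obtain ⟨M, y', ι, -, hM, hsep', hbad', hE'⟩ := hpois
  have hg := hgap M y' hsep' hbad'
  have hnM : (n : ℝ) ≤ M := by
    have := Fintype.card_le_of_embedding ι
    simp only [Fintype.card_fin] at this
    exact_mod_cast this
  have hG0 : (0 : ℝ) ≤ Nat.card {k : Fin n // IsTwoShellGood (1 / 20) (47 / 50) 1 y k} :=
    Nat.cast_nonneg _
  have hE2 : 0 ≤ E + |E| + 2 * g₀ := by
    have := neg_abs_le E
    linarith
  have h1 := mul_nonneg (sub_nonneg.2 hnM) hE2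
  have h2 : ((M : ℝ) - n) * (|E| + g₀) ≤
      Nat.card {k : Fin n // IsTwoShellGood (1 / 20) (47 / 50) 1 y k} * (|E| + g₀) :=
    mul_le_mul_of_nonneg_right (by linarith) (by positivity)
  linarith

/-- **The core estimate** for an enumerated bad set `U = Finset.univ.map e`: with the constants
of the glue, `(g₀/2) · n - C · #∂_R U ≤ ∑_{i ∈ U} (½ ∑_{j ≠ i} V_LJ(|xᵢ - xⱼ|) - E)`. -/
private theorem glue_core {N n : ℕ} (x : Fin N → EuclideanSpace ℝ (Fin 3)) (e : Fin n ↪ Fin N)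
    {δ δ' g₀ K R E : ℝ} (hδ : 0 < δ) (hδ'δ : δ' ≤ δ) (hK : 0 ≤ K) (hg₀ : 0 < g₀)
    (hR : 3 / 2 ≤ R) (hδR : δ ≤ R) (hRg : 250 / 12 * (δ⁻¹ ^ 3 * R⁻¹ ^ 3) ≤ g₀ / 2)
    (hpois : ∀ (n : ℕ) (y : Fin n → EuclideanSpace ℝ (Fin 3)),
      (∀ i j : Fin n, i ≠ j → δ' ≤ dist (y i) (y j)) →
      ∃ (M : ℕ) (y' : Fin M → EuclideanSpace ℝ (Fin 3)) (ι : Fin n ↪ Fin M),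
        (∀ k, y' (ι k) = y k) ∧
        (M : ℝ) ≤ n + Nat.card {k : Fin n // IsTwoShellGood (1 / 20) (47 / 50) 1 y k} ∧
        (∀ i j : Fin M, i ≠ j → δ' ≤ dist (y' i) (y' j)) ∧
        (∀ k, ¬ IsTwoShellGood (1 / 20) (47 / 50) 1 y' k) ∧
        interactionEnergy lennardJones y' ≤ interactionEnergy lennardJones y +
          K * Nat.card {k : Fin n // IsTwoShellGood (1 / 20) (47 / 50) 1 y k})
    (hgap : ∀ (N : ℕ) (x : Fin N → EuclideanSpace ℝ (Fin 3)),
      (∀ i j : Fin N, i ≠ j → δ' ≤ dist (x i) (x j)) →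
      (∀ i : Fin N, ¬ IsTwoShellGood (1 / 20) (47 / 50) 1 x i) →
      (N : ℝ) * (E + g₀) ≤ interactionEnergy lennardJones x)
    (hT : ∀ (i : Fin N) (T : Finset (Fin N)), (∀ j ∈ T, R ≤ dist (x i) (x j)) →
      ∑ j ∈ T, (dist (x i) (x j))⁻¹ ^ 6 ≤ 250 * (δ⁻¹ ^ 3 * R⁻¹ ^ 3))
    (hL : ∀ k : Fin n, (∀ j : Fin N, dist (x j) (x (e k)) ≤ 3 / 2 → j ∈ Set.range e) →
      IsTwoShellGood (1 / 20) (47 / 50) 1 (x ∘ e) k →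
        IsTwoShellGood (1 / 20) (47 / 50) 1 x (e k))
    (hD : ∑ i ∈ Finset.univ.map e, (1 / 2 : ℝ) *
        (∑ j ∈ Finset.univ.erase i, lennardJones (dist (x i) (x j))) =
      interactionEnergy lennardJones (x ∘ e) +
        (1 / 2 : ℝ) * ∑ k : Fin n, ∑ j ∈ (Finset.univ.map e)ᶜ,
          lennardJones (dist (x (e k)) (x j)))
    (hsep : ∀ i j : Fin N, i ≠ j → δ ≤ dist (x i) (x j))
    (hU : ∀ k : Fin n, ¬ IsTwoShellGood (1 / 20) (47 / 50) 1 x (e k)) :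
    g₀ / 2 * (n : ℝ) - (K + |E| + g₀ + 250 / 12 * δ⁻¹ ^ 6) *
        (Nat.card {i : Fin N // i ∈ Finset.univ.map e ∧
          ∃ j : Fin N, j ∉ Finset.univ.map e ∧ dist (x j) (x i) ≤ R} : ℝ) ≤
      ∑ i ∈ Finset.univ.map e, ((1 / 2 : ℝ) * (∑ j ∈ Finset.univ.erase i,
        lennardJones (dist (x i) (x j))) - E) := by
  -- the boundary count, re-indexed by `Fin n`
  have hB : Nat.card {i : Fin N // i ∈ Finset.univ.map e ∧
      ∃ j : Fin N, j ∉ Finset.univ.map e ∧ dist (x j) (x i) ≤ R} =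
      (Finset.univ.filter fun k : Fin n =>
        ∃ j : Fin N, j ∉ Finset.univ.map e ∧ dist (x j) (x (e k)) ≤ R).card := by
    rw [Nat.subtype_card ((Finset.univ.map e).filter fun i =>
        ∃ j : Fin N, j ∉ Finset.univ.map e ∧ dist (x j) (x i) ≤ R) (fun i => Finset.mem_filter),
      Finset.filter_map, Finset.card_map]
    rfl
  -- the good count of the sub-configuration
  have hG : Nat.card {k : Fin n // IsTwoShellGood (1 / 20) (47 / 50) 1 (x ∘ e) k} =
      (Finset.univ.filter fun k : Fin n => IsTwoShellGood (1 / 20) (47 / 50) 1 (x ∘ e) k).card :=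
    Nat.subtype_card _ fun k => by simp only [Finset.mem_filter, Finset.mem_univ, true_and]
  have hGB : (Nat.card {k : Fin n // IsTwoShellGood (1 / 20) (47 / 50) 1 (x ∘ e) k} : ℝ) ≤
      (Finset.univ.filter fun k : Fin n =>
        ∃ j : Fin N, j ∉ Finset.univ.map e ∧ dist (x j) (x (e k)) ≤ R).card := by
    rw [hG]
    exact_mod_cast Finset.card_le_card (glue_good_subset x e hR hL hU)
  -- the sub-configuration is `δ'`-separated
  have hsepy : ∀ i j : Fin n, i ≠ j → δ' ≤ dist ((x ∘ e) i) ((x ∘ e) j) := fun i j hij =>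
    hδ'δ.trans (hsep _ _ (e.injective.ne hij))
  have hbulk := glue_bulk (x ∘ e) hg₀ (hpois n (x ∘ e) hsepy) hgap
  have hcross := glue_cross x e hδ hδR hsep hT
  have h1 := mul_le_mul_of_nonneg_left hGB (show (0 : ℝ) ≤ K + |E| + g₀ by positivity)
  have h2 : 250 / 12 * (δ⁻¹ ^ 3 * R⁻¹ ^ 3) * n ≤ g₀ / 2 * n :=
    mul_le_mul_of_nonneg_right hRg (Nat.cast_nonneg n)
  rw [hB, Finset.sum_sub_distrib, Finset.sum_const, Finset.card_map, Finset.card_univ,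
    Fintype.card_fin, nsmul_eq_mul, hD]
  linarith

/-! ## The stub -/

/-- Stub (bookkeeping): THE GLUE, concluding the verbatim body of the route decl `FarFieldGapR`
from the support item `AllBadGap`, the poisoning of everything (`hP`), the decaying shell sum
(`hT`), locality (`hL`) and the decomposition (`hD`).  For `δ > 0` put `δ' := min δ (3/5)`, take
`K` and the poisoning from `hP` at `δ'`, `g₀` from `AllBadGap` at `δ'`; answer `g := g₀/2`,
`R ≥ max (3/2) δ` enlarged until `(250/12) δ⁻³ R⁻³ ≤ g₀/2`, `C := K + |e*| + g₀ + (250/12) δ⁻⁶`.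
Given `x` and a bad set `U`, let `e : Fin n ↪ Fin N` enumerate `U` (`Finset.univ.map e = U`,
`e := U.orderEmbOfFin rfl`) and `y := x ∘ e`.  By `hD`, `∑_{i∈U} ½∑_{j≠i} V = 𝓔(y) + ½·cross`; the
cross terms of an `R`-interior particle of `U` are `≥ -(250/6) δ⁻³R⁻³` (`hT`, `V_LJ(r) ≥ -r⁻⁶/6`),
of an `R`-boundary particle `≥ -(250/6) δ⁻⁶` (`sum_inv_pow_six_le`); `hP` + `AllBadGap`:
`𝓔(y) ≥ M(e* + g₀) - K·#good(y) ≥ n(e* + g₀) - (K + |e*| + g₀)·#good(y)` (`n ≤ M ≤ n + #good(y)`);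
`hL`: a good particle of `y` is bad in `x` (hypothesis on `U`), hence has a particle outside `U`
within `3/2 ≤ R`, so `#good(y) ≤ #∂_R U`. -/
theorem stub_glue (hA : AllBadGap)
    (hP : ∀ δ : ℝ, 0 < δ → δ ≤ 3 / 5 → ∃ K : ℝ, 0 ≤ K ∧
      ∀ (n : ℕ) (y : Fin n → EuclideanSpace ℝ (Fin 3)),
        (∀ i j : Fin n, i ≠ j → δ ≤ dist (y i) (y j)) →
        ∃ (M : ℕ) (y' : Fin M → EuclideanSpace ℝ (Fin 3)) (ι : Fin n ↪ Fin M),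
          (∀ k, y' (ι k) = y k) ∧
          (M : ℝ) ≤ n + Nat.card {k : Fin n // IsTwoShellGood (1 / 20) (47 / 50) 1 y k} ∧
          (∀ i j : Fin M, i ≠ j → δ ≤ dist (y' i) (y' j)) ∧
          (∀ k, ¬ IsTwoShellGood (1 / 20) (47 / 50) 1 y' k) ∧
          interactionEnergy lennardJones y' ≤ interactionEnergy lennardJones y +
            K * Nat.card {k : Fin n // IsTwoShellGood (1 / 20) (47 / 50) 1 y k})
    (hT : ∀ (N : ℕ) (x : Fin N → EuclideanSpace ℝ (Fin 3)) (δ R : ℝ), 0 < δ → δ ≤ R →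
      (∀ i j : Fin N, i ≠ j → δ ≤ dist (x i) (x j)) →
      ∀ (i : Fin N) (T : Finset (Fin N)), (∀ j ∈ T, R ≤ dist (x i) (x j)) →
        ∑ j ∈ T, (dist (x i) (x j))⁻¹ ^ 6 ≤ 250 * (δ⁻¹ ^ 3 * R⁻¹ ^ 3))
    (hL : ∀ (N n : ℕ) (x : Fin N → EuclideanSpace ℝ (Fin 3)) (e : Fin n ↪ Fin N) (k : Fin n),
      (∀ j : Fin N, dist (x j) (x (e k)) ≤ 3 / 2 → j ∈ Set.range e) →
        IsTwoShellGood (1 / 20) (47 / 50) 1 (x ∘ e) k →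
          IsTwoShellGood (1 / 20) (47 / 50) 1 x (e k))
    (hD : ∀ (V : ℝ → ℝ) (N n : ℕ) (x : Fin N → EuclideanSpace ℝ (Fin 3)) (e : Fin n ↪ Fin N),
      ∑ i ∈ Finset.univ.map e, (1 / 2 : ℝ) * (∑ j ∈ Finset.univ.erase i, V (dist (x i) (x j))) =
        interactionEnergy V (x ∘ e) +
          (1 / 2 : ℝ) * ∑ k : Fin n, ∑ j ∈ (Finset.univ.map e)ᶜ, V (dist (x (e k)) (x j))) :
    ∀ δ : ℝ, 0 < δ → ∃ g : ℝ, 0 < g ∧ ∃ C R : ℝ, ∀ (N : ℕ) (x : Fin N → EuclideanSpace ℝ (Fin 3)),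
      (∀ i j : Fin N, i ≠ j → δ ≤ dist (x i) (x j)) → ∀ U : Finset (Fin N),
      (∀ i ∈ U, ¬ Literature.Geometry.DiscreteGeometry.IsTwoShellGood (1 / 20) (47 / 50) 1 x i) →
      g * (U.card : ℝ) - C * (Nat.card {i : Fin N // i ∈ U ∧ ∃ j : Fin N, j ∉ U ∧ dist (x j) (x i) ≤ R} : ℝ) ≤
        ∑ i ∈ U, ((1 / 2 : ℝ) * (∑ j ∈ Finset.univ.erase i,
          Literature.MathematicalPhysics.StatisticalMechanics.lennardJones (dist (x i) (x j))) -
          (⨅ Q : Literature.MathematicalPhysics.StatisticalMechanics.PeriodicConfiguration 3,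
            Q.energyPerParticle Literature.MathematicalPhysics.StatisticalMechanics.lennardJones)) := by
  intro δ hδ
  have hδ'0 : 0 < min δ (3 / 5) := lt_min hδ (by norm_num)
  obtain ⟨K, hK, hpois⟩ := hP (min δ (3 / 5)) hδ'0 (min_le_right _ _)
  obtain ⟨g₀, hg₀, hgap⟩ := hA (min δ (3 / 5)) hδ'0
  obtain ⟨R, hR, hδR, hRg⟩ := glue_radius hδ hg₀
  refine ⟨g₀ / 2, half_pos hg₀,
    K + |⨅ Q : PeriodicConfiguration 3, Q.energyPerParticle lennardJones| + g₀ +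
      250 / 12 * δ⁻¹ ^ 6, R, fun N x hsep U hU => ?_⟩
  -- enumerate `U`
  obtain ⟨n, e, rfl⟩ : ∃ (n : ℕ) (e : Fin n ↪ Fin N), Finset.univ.map e = U :=
    ⟨U.card, (U.orderEmbOfFin rfl).toEmbedding, Finset.map_orderEmbOfFin_univ U rfl⟩
  rw [Finset.card_map, Finset.card_univ, Fintype.card_fin]
  exact glue_core x e hδ (min_le_left _ _) hK hg₀ hR hδR hRg hpois hgap (hT N x δ R hδ hδR hsep)
    (hL N n x e) (hD lennardJones N n x e) hsep
    fun k => hU (e k) (Finset.mem_map_of_mem e (Finset.mem_univ k))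

end Summit.AtomisticToContinuum.Crystallization.Theorems.PhononSlackCertificatesFarFieldGapR

end
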